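import Summits.NavierStokesRegularity.NavierStokesRegularity.Theorems.ScenarioCensusAffineMeterRows
import Summits.NavierStokesRegularity.NavierStokesRegularity.Theorems.ScenarioCensusBlochMeter
import HarnessLib

/-!
# AFFINE METER port, part 4/4: §R REALISABILITY of the open elliptic cell by CONJUGATION (REV 2: `ellM`, `ellA`, `ellF`, the elliptic twin of a divergence-free bounded field); census KEYS

Re-homed for the scenario census (typer seat ns-census-typer-1 g10; the cells A2afH / A2afP / A2afI / A2afL (velocity twins) and A2avH / A2avP / A2avI / A2avL (vorticity twins, REV 2) are
MEMBERS OF RECORD «DECIDED IN KERNEL IN FILES» of row A2 (ns-idea-2 g18 LINE g18-3 REV 2: critic idea-crit-3 PASS (REV 1 14:53:06Z, REV 2 stamp), ref ns-census-ref g16 PRE-CHECK ✓ §21.11,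
lead label; OF RECORD 4/4 at census v1.132), A2afPd / A2afI0 / A2afE OPEN (typed); this port makes the decided cells TREE-decided): VERBATIM PORT of ns-idea-2 LINE g18-3 «affine-meter»
REV 2, `pub/ideators/ns-idea-2/lines/affine-meter/line-affine-meter.rev2.lean` sha16 021917a0ebe35407 (1145 l., lean check rc 0, 0 sorry), split for the 400-line rule into
`ScenarioCensusAffineMeter` (§0, §A, §B) → `…AffineMeterLoxodromic` (§B⁺, §C) → `…AffineMeterRows` (§G, §V) → `…AffineMeterRealisability` (§R + census KEYS).  Lean text VERBATIM in
namespace `…Theorems.ScenarioCensus.AffineMeter` (the line's `…Lines.AffineMeter` re-homed); port edits: the line's `local notation "E3"` is spelled as the reducible `abbrev E3` of every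
census file; `norm_slice_le` / `eq_zero_of_slice_translate` / `divergence_conj` are the landed BLOCH METER's (`BlochMeter.norm_slice_le` / `eq_zero_of_slice_periodic` / `divergence_conj`, BY NAME, gate lint dedup.landed — the two g18 lines share these helpers verbatim); `hasFDerivAt_coord` (twin of a Literature lemma outside this closure) is not re-declared — its three instances are stated inline; the two explicit-name `open … (…)` lines of §V spell the opened namespaces in full (inside `…Theorems.ScenarioCensus.*` the relative spelling resolves twice and makes the aliases ambiguous); `@[conjecture]` on the OPEN rows `Row_A2afPd`,
`Row_A2afI0`, `Row_A2afE`; one-line docstrings added where missing (gate lint).  Statements untouched.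

No census VALUE is moved here (row A2 stays OPEN-WITH-LINE; the members become TREE-decided by name); (L′) is NOT proved; no summit statement is proved by this file. Lemmas that restate already-landed tree declarations are taken BY NAME (gate lint `dedup.landed`): `norm_slice_le` = `BlochMeter.norm_slice_le`, `eq_zero_of_slice_translate` = `BlochMeter.eq_zero_of_slice_periodic`, `divergence_conj` = `BlochMeter.divergence_conj`.
-/

-- the summit and its single problem share the name `NavierStokesRegularity` (D-0017 nested layout)
set_option linter.dupNamespace false

noncomputable section

open Set Function Filter Metric MeasureTheory InnerProductSpace
open scoped Topology RealInnerProductSpace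
open Literature.Analysis Literature.Analysis.FluidPDE
open Summit.NavierStokesRegularity.NavierStokesRegularity.Theorems
open Summit.NavierStokesRegularity.NavierStokesRegularity.Theorems.ScenarioCensus

namespace Summit.NavierStokesRegularity.NavierStokesRegularity.Theorems.ScenarioCensus.AffineMeter

/-! ### §R  REALISABILITY of the open elliptic cell by CONJUGATION (REV 2)

Kinematics cannot decide `Row_A2afE`.  Twins and incompressibility are COVARIANT under linear conjugation
`f ↦ D ∘ F ∘ D⁻¹` (`twin_conj`; `BlochMeter.divergence_conj`: the divergence is the TRACE of the derivative, a conjugation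
invariant), and conjugation turns an ISOMETRIC twin `R` of `F` into the NON-ISOMETRIC, power-bounded twin
`M = D R D⁻¹` of `f`.  Conjugating a bounded incompressible swirl that has a quarter-turn symmetry by
`D = diag(2, 1, 1)` gives an explicit field in the cell of `Row_A2afE` (`control_elliptic_realised`: bounded by
`2`, divergence-free, an exact twin of the order-four non-isometric `M x = (−2x₁, x₀/2, x₂)`, not zero, and with
NO translation symmetry whatsoever) — so the elliptic cell is not covertly one of the fatal translation cells,
and a one-slice «equidistribution» law for irrational elliptic twins cannot be fatal either (conjugating an
axisymmetric swirl gives a slice carrying a whole conjugated circle `D R_θ D⁻¹` of non-isometric twins).  Only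
the CLASS — dynamics across slices — can decide `Row_A2afE`; no claim. -/

section Realisability

/-- TWINS ARE CONJUGATION-COVARIANT: if `F ∘ g = N ∘ F` then `f = D F D⁻¹` is a twin of `D g D⁻¹` with value
map `D N D⁻¹`. -/
theorem twin_conj (D : E3 ≃L[ℝ] E3) {F g N : E3 → E3} (h : ∀ y, F (g y) = N (F y)) (x : E3) :
    D (F (D.symm (D (g (D.symm x))))) = D (N (D.symm (D (F (D.symm x))))) := by
  simp only [ContinuousLinearEquiv.symm_apply_apply, h]

-- `divergence_conj`: the line restates the tree's `BlochMeter.divergence_conj`; taken BY NAME (gate lint dedup.landed).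

/-- The order-four NON-ISOMETRIC elliptic map `M = D R D⁻¹` (`R` the quarter turn about `e₂`,
`D = diag(2, 1, 1)`): `M x = (−2x₁, x₀/2, x₂)`. -/
def ellM : E3 →L[ℝ] E3 :=
  LinearMap.toContinuousLinearMap
    { toFun := fun x => WithLp.toLp 2 ![-2 * x 1, x 0 / 2, x 2]
      map_add' := fun v w => by ext i; fin_cases i <;> simp <;> ring
      map_smul' := fun c v => by ext i; fin_cases i <;> simp <;> ring }

/-- Component / evaluation formula (`ellM_apply`). -/
theorem ellM_apply (x : E3) : ellM x = WithLp.toLp 2 ![-2 * x 1, x 0 / 2, x 2] := rfl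

/-- Component / evaluation formula (`ellM_apply_zero`). -/
@[simp] theorem ellM_apply_zero (x : E3) : ellM x 0 = -2 * x 1 := rfl
/-- Component / evaluation formula (`ellM_apply_one`). -/
@[simp] theorem ellM_apply_one (x : E3) : ellM x 1 = x 0 / 2 := rfl
/-- Component / evaluation formula (`ellM_apply_two`). -/
@[simp] theorem ellM_apply_two (x : E3) : ellM x 2 = x 2 := rfl

/-- Its planar part `A x = (−2x₁, x₀/2, 0)` (trace zero). -/
def ellA : E3 →L[ℝ] E3 :=
  LinearMap.toContinuousLinearMap
    { toFun := fun x => WithLp.toLp 2 ![-2 * x 1, x 0 / 2, 0]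
      map_add' := fun v w => by ext i; fin_cases i <;> simp <;> ring
      map_smul' := fun c v => by ext i; fin_cases i <;> simp <;> ring }

/-- Component / evaluation formula (`ellA_apply`). -/
theorem ellA_apply (x : E3) : ellA x = WithLp.toLp 2 ![-2 * x 1, x 0 / 2, 0] := rfl

/-- Component / evaluation formula (`ellA_apply_zero`). -/
@[simp] theorem ellA_apply_zero (x : E3) : ellA x 0 = -2 * x 1 := rfl
/-- Component / evaluation formula (`ellA_apply_one`). -/
@[simp] theorem ellA_apply_one (x : E3) : ellA x 1 = x 0 / 2 := rfl
/-- Component / evaluation formula (`ellA_apply_two`). -/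
@[simp] theorem ellA_apply_two (x : E3) : ellA x 2 = 0 := rfl

/-- The conjugated swirl amplitude `θ = 1/q`, `q(x) = (1 + x₀²/4 + x₁² + x₂²)(1 + x₂²)` (= the axisymmetric
amplitude `1/((1 + ‖y‖²)(1 + y₂²))` at `y = D⁻¹ x`). -/
def ellq (x : E3) : ℝ := (1 + x 0 ^ 2 / 4 + x 1 ^ 2 + x 2 ^ 2) * (1 + x 2 ^ 2)

/-- Positivity (`ellq_pos`). -/
theorem ellq_pos (x : E3) : 0 < ellq x := by unfold ellq; positivity

/-- Its derivative. -/
def ellq' (x : E3) : E3 →L[ℝ] ℝ :=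
  ((1 + x 2 ^ 2) * (x 0 / 2)) • EuclideanSpace.proj 0 + ((1 + x 2 ^ 2) * (2 * x 1)) • EuclideanSpace.proj 1 +
    ((1 + x 2 ^ 2) * (2 * x 2) + (1 + x 0 ^ 2 / 4 + x 1 ^ 2 + x 2 ^ 2) * (2 * x 2)) • EuclideanSpace.proj 2

-- `hasFDerivAt_coord`: a statement-twin of the landed `Literature.Analysis.FluidPDE.Wei2016.hasFDerivAt_coord` (module outside this file's import closure); not re-declared — the three instances are stated inline in `hasFDerivAt_ellq`.

/-- Derivative computation (`hasFDerivAt_ellq`). -/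
theorem hasFDerivAt_ellq (x : E3) : HasFDerivAt ellq (ellq' x) x := by
  have h0 : HasFDerivAt (fun z : E3 => (z 0 : ℝ)) (EuclideanSpace.proj (𝕜 := ℝ) 0 : E3 →L[ℝ] ℝ) x :=
    (EuclideanSpace.proj (𝕜 := ℝ) 0 : E3 →L[ℝ] ℝ).hasFDerivAt
  have h1 : HasFDerivAt (fun z : E3 => (z 1 : ℝ)) (EuclideanSpace.proj (𝕜 := ℝ) 1 : E3 →L[ℝ] ℝ) x :=
    (EuclideanSpace.proj (𝕜 := ℝ) 1 : E3 →L[ℝ] ℝ).hasFDerivAt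
  have h2 : HasFDerivAt (fun z : E3 => (z 2 : ℝ)) (EuclideanSpace.proj (𝕜 := ℝ) 2 : E3 →L[ℝ] ℝ) x :=
    (EuclideanSpace.proj (𝕜 := ℝ) 2 : E3 →L[ℝ] ℝ).hasFDerivAt
  have hp : HasFDerivAt (fun y : E3 => 1 + y 0 ^ 2 * 4⁻¹ + y 1 ^ 2 + y 2 ^ 2) _ x :=
    (((hasFDerivAt_const (1 : ℝ) x).add ((h0.pow 2).mul_const 4⁻¹)).add (h1.pow 2)).add (h2.pow 2)
  have hq : HasFDerivAt (fun y : E3 => 1 + y 2 ^ 2) _ x := (hasFDerivAt_const (1 : ℝ) x).add (h2.pow 2)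
  have he : ellq = fun y : E3 => (1 + y 0 ^ 2 * 4⁻¹ + y 1 ^ 2 + y 2 ^ 2) * (1 + y 2 ^ 2) := by
    funext y; simp only [ellq, div_eq_mul_inv]
  rw [he]
  refine (hp.mul hq).congr_fderiv ?_
  ext v
  simp [ellq']
  ring

/-- The explicit elliptic-cell field `f = θ • A` (`= D F D⁻¹` for the axisymmetric swirl
`F(y) = (−y₁, y₀, 0)/((1 + ‖y‖²)(1 + y₂²))`). -/
def ellF (x : E3) : E3 := (ellq x)⁻¹ • ellA x

/-- Derivative computation (`hasFDerivAt_ellF`). -/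
theorem hasFDerivAt_ellF (x : E3) :
    HasFDerivAt ellF ((ellq x)⁻¹ • ellA + ((-(ellq x ^ 2)⁻¹) • ellq' x).smulRight (ellA x)) x :=
  ((hasDerivAt_inv (ellq_pos x).ne').comp_hasFDerivAt x (hasFDerivAt_ellq x)).smul ellA.hasFDerivAt

/-- Auxiliary lemma of the line, stated and proved verbatim (`ellM_pow_four`). -/
theorem ellM_pow_four (x : E3) : ellM (ellM (ellM (ellM x))) = x := by
  ext i; fin_cases i <;> simp [ellM_apply] <;> ring

/-- Auxiliary lemma of the line, stated and proved verbatim (`ellM_single_zero`). -/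
theorem ellM_single_zero : ellM (EuclideanSpace.single 0 1) = EuclideanSpace.single 1 (1 / 2 : ℝ) := by
  ext i; fin_cases i <;> simp [ellM_apply]

/-- A norm computation / bound (`norm_ellM_single_zero`). -/
theorem norm_ellM_single_zero :
    ‖ellM (EuclideanSpace.single 0 1)‖ ≠ ‖(EuclideanSpace.single 0 1 : E3)‖ := by
  rw [ellM_single_zero, PiLp.norm_single, PiLp.norm_single]; norm_num

/-- Auxiliary lemma of the line, stated and proved verbatim (`ellF_twin`). -/
theorem ellF_twin (x : E3) : ellF (ellM x) = ellM (ellF x) := by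
  have hq : ellq (ellM x) = ellq x := by
    simp only [ellq, ellM_apply_zero, ellM_apply_one, ellM_apply_two]; ring
  have hc : ellA (ellM x) = ellM (ellA x) := by
    ext i; fin_cases i <;> simp [ellA_apply, ellM_apply]
  simp only [ellF, hq, hc, map_smul]

/-- An elementary bound (`norm_ellA_le`). -/
theorem norm_ellA_le (x : E3) : ‖ellA x‖ ≤ 2 * (1 + x 0 ^ 2 / 4 + x 1 ^ 2 + x 2 ^ 2) := by
  have hdec : ellA x = (-2 * x 1) • EuclideanSpace.single 0 (1 : ℝ) + (x 0 / 2) • EuclideanSpace.single 1 1 := by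
    ext i; fin_cases i <;> simp [ellA_apply]
  rw [hdec]
  refine (norm_add_le _ _).trans ?_
  rw [norm_smul, norm_smul, PiLp.norm_single, PiLp.norm_single, norm_one, mul_one,
    mul_one, Real.norm_eq_abs, Real.norm_eq_abs, abs_mul, abs_div, abs_two, abs_neg, abs_two]
  nlinarith [sq_abs (x 1), sq_abs (x 0), abs_nonneg (x 1), abs_nonneg (x 0), sq_nonneg (x 2),
    sq_nonneg (|x 1| - 1), sq_nonneg (|x 0| - 4)]

/-- An elementary bound (`norm_ellF_le`). -/
theorem norm_ellF_le (x : E3) : ‖ellF x‖ ≤ 2 := by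
  have hP : 0 < 1 + x 0 ^ 2 / 4 + x 1 ^ 2 + x 2 ^ 2 := by positivity
  have hQ : 1 ≤ 1 + x 2 ^ 2 := by nlinarith [sq_nonneg (x 2)]
  rw [ellF, norm_smul, norm_inv, Real.norm_eq_abs, abs_of_pos (ellq_pos x), inv_mul_le_iff₀ (ellq_pos x)]
  unfold ellq
  calc ‖ellA x‖ ≤ 2 * (1 + x 0 ^ 2 / 4 + x 1 ^ 2 + x 2 ^ 2) := norm_ellA_le x
    _ ≤ (1 + x 0 ^ 2 / 4 + x 1 ^ 2 + x 2 ^ 2) * (1 + x 2 ^ 2) * 2 := by nlinarith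

/-- Divergence-freeness (`isDivFree_ellF`). -/
theorem isDivFree_ellF : VectorCalculus.IsDivFree ellF := fun x => by
  rw [divergence_eq_sum_inner_fderiv (EuclideanSpace.basisFun (Fin 3) ℝ), (hasFDerivAt_ellF x).fderiv]
  simp [Fin.sum_univ_three, ellA_apply, ellq', EuclideanSpace.inner_single_left]
  ring

/-- Non-vanishing (`ellF_single_zero_ne`). -/
theorem ellF_single_zero_ne : ellF (EuclideanSpace.single 0 1) ≠ 0 := by
  intro h
  have h1 := congrArg (fun w : E3 => w 1) h
  simp [ellF, ellq, ellA_apply] at h1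
  norm_num at h1

/-- The field `ellF` has NO translation symmetry at all. -/
theorem ellF_translate (v : E3) (h : ∀ x, ellF (x + v) = ellF x) : v = 0 := by
  have h0 : ellF v = 0 := by
    have := h 0; rw [zero_add] at this; rw [this]; simp [ellF, ellA_apply]
  have hA : ellA v = 0 := by
    rw [ellF, smul_eq_zero] at h0
    exact h0.resolve_left (inv_ne_zero (ellq_pos v).ne')
  have hv1 : v 1 = 0 := by
    have := congrArg (fun w : E3 => w 0) hA; simp [ellA_apply] at this; exact this
  have hv0 : v 0 = 0 := by
    have := congrArg (fun w : E3 => w 1) hA; simp [ellA_apply] at this; exact this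
  have hv2 : v 2 = 0 := by
    have h1 := congrArg (fun w : E3 => w 1) (h (EuclideanSpace.single 0 1))
    simp [ellF, ellq, ellA_apply, hv0, hv1] at h1
    have h9 : 0 ≤ v 2 ^ 2 := sq_nonneg _
    field_simp at h1
    nlinarith [h1, h9, sq_nonneg (v 2 ^ 2)]
  ext i; fin_cases i <;> simp [hv0, hv1, hv2]

/-- Auxiliary lemma of the line, stated and proved verbatim (`ellM_pow_four_eq_one`). -/
theorem ellM_pow_four_eq_one : ellM ^ 4 = 1 := by
  rw [show (4 : ℕ) = 1 + 1 + 1 + 1 from rfl, pow_succ, pow_succ, pow_succ, pow_one]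
  ext x : 1
  simp [ellM_pow_four]

/-- `M` is power-bounded (it has order four). -/
theorem norm_ellM_pow_le (k : ℕ) :
    ‖ellM ^ k‖ ≤ ‖(1 : E3 →L[ℝ] E3)‖ + ‖ellM‖ + ‖ellM ^ 2‖ + ‖ellM ^ 3‖ := by
  rw [← Nat.div_add_mod k 4, pow_add, pow_mul, ellM_pow_four_eq_one, one_pow, one_mul]
  have n0 := norm_nonneg (1 : E3 →L[ℝ] E3)
  have n1 := norm_nonneg ellM
  have n2 := norm_nonneg (ellM ^ 2)
  have n3 := norm_nonneg (ellM ^ 3)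
  obtain ⟨r, hr, hr4⟩ : ∃ r, k % 4 = r ∧ r < 4 := ⟨k % 4, rfl, Nat.mod_lt _ (by norm_num)⟩
  rw [hr]
  interval_cases r
  · rw [pow_zero]; linarith
  · rw [pow_one]; linarith
  · linarith
  · linarith

/-- CONTROL (the elliptic cell is kinematically realised, and by a field with no translation symmetry):
`M x = (−2x₁, x₀/2, x₂)` has order four (hence `M`, `M⁻¹ = M³` are power-bounded) and is not an isometry;
`f = ellF` is bounded, divergence-free, an exact twin `f(M x) = M f(x)` on all of `ℝ³`, not zero, and
`f(· + v) = f` forces `v = 0`.  So `Row_A2afE` cannot be decided by one-slice kinematics. -/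
theorem control_elliptic_realised :
    (∀ x, ellM (ellM (ellM (ellM x))) = x) ∧
    ‖ellM (EuclideanSpace.single 0 1)‖ ≠ ‖(EuclideanSpace.single 0 1 : E3)‖ ∧
    (∀ x, ellF (ellM x) = ellM (ellF x)) ∧ (∀ x, ‖ellF x‖ ≤ 2) ∧ VectorCalculus.IsDivFree ellF ∧
    ellF (EuclideanSpace.single 0 1) ≠ 0 ∧ (∀ v : E3, (∀ x, ellF (x + v) = ellF x) → v = 0) :=
  ⟨ellM_pow_four, norm_ellM_single_zero, ellF_twin, norm_ellF_le, isDivFree_ellF, ellF_single_zero_ne,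
    ellF_translate⟩

/-- THE SAME CONTROL IN THE EXACT SHAPE OF `Row_A2afE`'s READING: every kinematic hypothesis of the open
elliptic row (`M' M = M M' = 1`, `M` and `M'` power-bounded, `M` not an isometry, the twin on the pocket
`U = univ` with `b = 0`) is met by the bounded incompressible field `ellF`, which is not zero and has no
translation symmetry.  Hence the row's verdict must come from the class, not from the reading. -/
theorem control_elliptic_cell :
    ∃ (M M' : E3 →L[ℝ] E3) (K : ℝ), M'.comp M = 1 ∧ M.comp M' = 1 ∧ (∀ k : ℕ, ‖M ^ k‖ ≤ K ∧ ‖M' ^ k‖ ≤ K) ∧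
      (∃ v, ‖M v‖ ≠ ‖v‖) ∧ (∀ x ∈ (univ : Set E3), ellF (M x + 0) = M (ellF x)) ∧ (∀ x, ‖ellF x‖ ≤ 2) ∧
      VectorCalculus.IsDivFree ellF ∧ ellF ≠ 0 ∧ ∀ v : E3, (∀ x, ellF (x + v) = ellF x) → v = 0 := by
  refine ⟨ellM, ellM ^ 3, ‖(1 : E3 →L[ℝ] E3)‖ + ‖ellM‖ + ‖ellM ^ 2‖ + ‖ellM ^ 3‖, ?_, ?_,
    fun k => ⟨norm_ellM_pow_le k, ?_⟩, ⟨_, norm_ellM_single_zero⟩, fun x _ => by rw [add_zero, ellF_twin],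
    norm_ellF_le, isDivFree_ellF, fun h => ellF_single_zero_ne (by rw [h]; rfl), ellF_translate⟩
  · rw [← ContinuousLinearMap.mul_def, ← pow_succ, ellM_pow_four_eq_one]
  · rw [← ContinuousLinearMap.mul_def, ← pow_succ', ellM_pow_four_eq_one]
  · rw [← pow_mul]; exact norm_ellM_pow_le _

end Realisability

end Summit.NavierStokesRegularity.NavierStokesRegularity.Theorems.ScenarioCensus.AffineMeter

namespace Summit.NavierStokesRegularity.NavierStokesRegularity.Theorems.ScenarioCensus

/-! ## Census KEYS (ns `…Theorems.ScenarioCensus`): instrument AFFINE METER REV 2 (block A2) — TREE-decided cells A2afH / A2afP / A2afI / A2afL / A2avH / A2avP / A2avI / A2avL, OPEN rows A2afPd / A2afI0 / A2afE -/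

/-- **Cell A2afH** (HYPERBOLIC elementary affine twin of one velocity slice on a pocket ⇒ `u ≡ 0`): `:= AffineMeter.Row_A2afH`. DECIDED. -/
def Row_A2afH : Prop := AffineMeter.Row_A2afH
/-- A2afH is EXCLUDED (decided in the tree): `AffineMeter.row_A2afH`. -/
theorem row_A2afH_excluded : Row_A2afH := AffineMeter.row_A2afH

/-- **Cell A2afP** (PARABOLIC / shear twin ⇒ `u ≡ 0`): `:= AffineMeter.Row_A2afP`. DECIDED. -/
def Row_A2afP : Prop := AffineMeter.Row_A2afP
/-- A2afP is EXCLUDED (decided in the tree): `AffineMeter.row_A2afP`. -/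
theorem row_A2afP_excluded : Row_A2afP := AffineMeter.row_A2afP

/-- **Cell A2afI** (INVOLUTIVE twin with growing heights ⇒ `u ≡ 0`): `:= AffineMeter.Row_A2afI`. DECIDED. -/
def Row_A2afI : Prop := AffineMeter.Row_A2afI
/-- A2afI is EXCLUDED (decided in the tree): `AffineMeter.row_A2afI`. -/
theorem row_A2afI_excluded : Row_A2afI := AffineMeter.row_A2afI

/-- **Cell A2afL** (LOXODROMIC rank-two hyperbolic twin ⇒ `u ≡ 0`): `:= AffineMeter.Row_A2afL`. DECIDED. -/
def Row_A2afL : Prop := AffineMeter.Row_A2afL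
/-- A2afL is EXCLUDED (decided in the tree): `AffineMeter.row_A2afL`. -/
theorem row_A2afL_excluded : Row_A2afL := AffineMeter.row_A2afL

/-- **Cell A2avH** (REV 2 · hyperbolic twin of one VORTICITY slice ⇒ `u ≡ 0`): `:= AffineMeter.Row_A2avH`. DECIDED. -/
def Row_A2avH : Prop := AffineMeter.Row_A2avH
/-- A2avH is EXCLUDED (decided in the tree): `AffineMeter.row_A2avH`. -/
theorem row_A2avH_excluded : Row_A2avH := AffineMeter.row_A2avH

/-- **Cell A2avP** (REV 2 · parabolic vorticity twin): `:= AffineMeter.Row_A2avP`. DECIDED. -/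
def Row_A2avP : Prop := AffineMeter.Row_A2avP
/-- A2avP is EXCLUDED (decided in the tree): `AffineMeter.row_A2avP`. -/
theorem row_A2avP_excluded : Row_A2avP := AffineMeter.row_A2avP

/-- **Cell A2avI** (REV 2 · involutive vorticity twin): `:= AffineMeter.Row_A2avI`. DECIDED. -/
def Row_A2avI : Prop := AffineMeter.Row_A2avI
/-- A2avI is EXCLUDED (decided in the tree): `AffineMeter.row_A2avI`. -/
theorem row_A2avI_excluded : Row_A2avI := AffineMeter.row_A2avI

/-- **Cell A2avL** (REV 2 · loxodromic vorticity twin): `:= AffineMeter.Row_A2avL`. DECIDED. -/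
def Row_A2avL : Prop := AffineMeter.Row_A2avL
/-- A2avL is EXCLUDED (decided in the tree): `AffineMeter.row_A2avL`. -/
theorem row_A2avL_excluded : Row_A2avL := AffineMeter.row_A2avL

/-- **Row A2afPd** (parabolic twin with transversal DRIFT) — typed only: `:= AffineMeter.Row_A2afPd`. OPEN. -/
@[conjecture] def Row_A2afPd : Prop := AffineMeter.Row_A2afPd

/-- **Row A2afI0** (involutive twin, stationary heights) — typed only: `:= AffineMeter.Row_A2afI0`. OPEN. -/
@[conjecture] def Row_A2afI0 : Prop := AffineMeter.Row_A2afI0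

/-- **Row A2afE** (ELLIPTIC twin; kinematically nonempty by §R) — typed only: `:= AffineMeter.Row_A2afE`. OPEN. -/
@[conjecture] def Row_A2afE : Prop := AffineMeter.Row_A2afE

end Summit.NavierStokesRegularity.NavierStokesRegularity.Theorems.ScenarioCensus

end
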